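import Summits.AtomisticToContinuum.HydrodynamicLimit.Theorems.BoxDissipativeWeakStrongFluxClosureKineticIsotropyTight
import Summits.AtomisticToContinuum.HydrodynamicLimit.Theorems.BoxDissipativeWeakStrongFluxClosureOfParts
import Literature.Analysis.FunctionSpaces.TorusSpaceTime
import HarnessLib

/-!
# Crux `FluxClosure` (stmt-AtomisticToContinuum-9902, route BoxDissipativeWeakStrong), line `registered`
# (= birth r3): uniform `L¹(P_N)` tightness of the collisional deviation (open stub V, `stub_collisionalVirial`)

Support file (`--supports stmt-AtomisticToContinuum-9902`) of the continuation lead. The open stub V asserts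
`CollDev_N → 0` in `L¹(P_N)`, `CollDev_N = C_w − ∫_0^τ∫ ρ̂θ̂ (Z(min(ρ̂σ³, η₁)) − 1) div w`, where `C_w` is the
time-integrated collisional momentum transfer tested against the box average of `w` — a sum over the collisions of
the orbit whose integrability under the local Gibbs law is NOT obvious term by term (it involves collision-count
moments). This file proves that it is nevertheless uniformly bounded in `L¹(P_N)`, with no collision estimate at
all: by the landed exact balance identity `FluxClosureGlue.boxMomentumBalance` (`D_N = CollDev_N + KinDev_N` on the
good set), `|CollDev_N| ≤ |D_N| + |KinDev_N|`, and both the momentum-balance defect `D_N` of the box fields and the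
kinetic deviation `KinDev_N` are dominated pathwise by the conserved kinetic energy:

* `abs_integral_inner_momentum_le` — `|∫⟪m̂, φ⟫ dx| ≤ sup‖φ‖ · (N+1)⁻¹Σ_a‖v_a‖` (cube kernel of unit mass);
* `abs_integral_interior_le` — `|∫(⟪m̂, ψ⟫ + (m̂⊗m̂/ρ̂):∇φ + ρ̂θ̂ Z(min(ρ̂σ³,η₁)) div φ) dx|
   ≤ sup‖ψ‖ (N+1)⁻¹Σ‖v_a‖ + (9 + Z_max) C (N+1)⁻¹Σ‖v_a‖²` whenever `|Z| ≤ Z_max` on `[0, η₁]` (Cauchy–Schwarz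
  `|m̂_im̂_j/ρ̂| ≤ 2Ê`, `|ρ̂θ̂| ≤ ⅔Ê` of `DeviatoricStressClosure.abs_reynolds_le_and_abs_pressure_le`);
* `collisionalVirial_tight` (registered sub-goal) — in the crux's frame, for `0 ≤ σ ≤ 1/2`, `0 ≤ η₁`, `|Z| ≤ Z_max`
  on `[0,η₁]`, continuous profiles with `3θ₀ + ‖u₀‖² ≤ B₁`, every flow family, window `0 < ℓ_N ≤ 1`, `τ ∈ [0,T)` and
  smooth `w`: `∃ C ≥ 0, ∀ N, ∫⁻ |CollDev_N| dP_N ≤ C (1 + B₁)`.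

So, as for K (`FluxClosureK.kineticIsotropy_tight`), the `L¹(P_N)` norms whose vanishing V asserts are uniformly
bounded; V's content is the limit (the local contact-value virial law along the deterministic flow; Spohn 1991,
Part I (3.15)), for which no theorem exists at fixed reduced density. The hypothesis `|Z| ≤ Z_max` on `[0, η₁]` is
discharged in the crux's frame by choosing `η_c` below the continuity threshold of
`hsCompressibility_continuousOn` (or below `η₀` of `HsEosLowDensity`). No definitions.
References: H. Spohn, *Large Scale Dynamics of Interacting Particles* (1991), Part I §2.3, §3.2–3.3.
-/

noncomputable section

namespace Summit.AtomisticToContinuum.HydrodynamicLimit.Theorems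
namespace FluxClosureVT

open scoped BigOperators Topology Classical MeasureTheory ProbabilityTheory InnerProductSpace ENNReal
open Filter Set Function MeasureTheory
open Literature.MathematicalPhysics.KineticTheory Literature.Analysis.FluidPDE Literature.Analysis.FunctionSpaces
open DeviatoricStressClosure NearConstantShortTimeHL

variable {n : ℕ}

/-! ### Frozen-configuration bounds -/

/-- `‖m̂‖ ≤ n⁻¹ Σ_a χ(q_a) ‖v_a‖` for a weight `χ ≥ 0`. [folklore] -/
theorem norm_momentum_le (c : Config n (Fin 3) T3) {χ : T3 → ℝ} (hχ : ∀ y, 0 ≤ χ y) :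
    ‖empiricalMomentumField c χ‖ ≤ (n : ℝ)⁻¹ * ∑ a, χ (c a).1 * ‖(c a).2‖ := by
  have hc0 : 0 ≤ (n : ℝ)⁻¹ := inv_nonneg.2 (Nat.cast_nonneg n)
  rw [empiricalMomentumField_eq_sum, norm_smul, Real.norm_eq_abs, abs_of_nonneg hc0]
  refine mul_le_mul_of_nonneg_left ((norm_sum_le _ _).trans (Finset.sum_le_sum fun a _ => ?_)) hc0
  rw [norm_smul, Real.norm_eq_abs, abs_of_nonneg (hχ _)]

/-- **Boundary pairing, pointwise**: `|⟪m̂(x), φ(x)⟫| ≤ W · n⁻¹Σ_a χ(q_a)‖v_a‖` if `‖φ‖ ≤ W`. [folklore] -/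
theorem abs_inner_momentum_le (c : Config n (Fin 3) T3) {χ : T3 → ℝ} (hχ : ∀ y, 0 ≤ χ y) {φ : T3 → V3}
    {W : ℝ} (hW : ∀ x, ‖φ x‖ ≤ W) (x : T3) :
    |inner ℝ (empiricalMomentumField c χ) (φ x)| ≤ W * ((n : ℝ)⁻¹ * ∑ a, χ (c a).1 * ‖(c a).2‖) := by
  have h0 : 0 ≤ (n : ℝ)⁻¹ * ∑ a, χ (c a).1 * ‖(c a).2‖ :=
    mul_nonneg (inv_nonneg.2 (Nat.cast_nonneg n))
      (Finset.sum_nonneg fun a _ => mul_nonneg (hχ _) (norm_nonneg _))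
  calc |inner ℝ (empiricalMomentumField c χ) (φ x)| ≤ ‖empiricalMomentumField c χ‖ * ‖φ x‖ :=
        abs_real_inner_le_norm _ _
    _ ≤ ((n : ℝ)⁻¹ * ∑ a, χ (c a).1 * ‖(c a).2‖) * W :=
        mul_le_mul (norm_momentum_le c hχ) (hW x) (norm_nonneg _) h0
    _ = W * ((n : ℝ)⁻¹ * ∑ a, χ (c a).1 * ‖(c a).2‖) := mul_comm _ _

/-- **Interior integrand, pointwise**: for a weight `χ ≥ 0`, `‖ψ‖ ≤ W₁`, `|∂_jφ_i| ≤ C`, `0 ≤ σ`, `0 ≤ η₁` and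
`|Z| ≤ Z_max` on `[0, η₁]`,
`|⟪m̂, ψ(x)⟫ + Σ_ij (m̂_im̂_j/ρ̂) ∂_jφ_i(x) + ρ̂θ̂ Z(min(ρ̂σ³, η₁)) div φ(x)| ≤ W₁ n⁻¹Σχ‖v‖ + (18 + 2Z_max) C Ê`
(`|m̂_im̂_j/ρ̂| ≤ 2Ê`, `|ρ̂θ̂| ≤ ⅔Ê`, `|div φ| ≤ 3C`, `0 ≤ ρ̂` so `min(ρ̂σ³, η₁) ∈ [0, η₁]`). [folklore] -/
theorem abs_interiorIntegrand_le (c : Config n (Fin 3) T3) (x : T3) {χ : T3 → ℝ} (hχ : ∀ y, 0 ≤ χ y)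
    {ψ φ : T3 → V3} {W₁ C : ℝ} (hW₁ : ∀ y, ‖ψ y‖ ≤ W₁)
    (hC : ∀ i j y, |Torus.partialDeriv j (fun y => φ y i) y| ≤ C)
    {σ η₁ Zmax : ℝ} (hσ : 0 ≤ σ) (hη₁ : 0 ≤ η₁) (hZ : ∀ η ∈ Icc 0 η₁, |hsCompressibility η| ≤ Zmax) :
    |inner ℝ (empiricalMomentumField c χ) (ψ x) +
        (∑ i, ∑ j, empiricalMomentumField c χ i * empiricalMomentumField c χ j / empiricalDensityField c χ *
          Torus.partialDeriv j (fun y => φ y i) x) +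
        empiricalDensityField c χ * (2 / 3 * (empiricalEnergyField c χ / empiricalDensityField c χ -
          ‖empiricalMomentumField c χ‖ ^ 2 / (2 * empiricalDensityField c χ ^ 2))) *
          hsCompressibility (min (empiricalDensityField c χ * σ ^ 3) η₁) * Torus.divergence φ x| ≤
      W₁ * ((n : ℝ)⁻¹ * ∑ a, χ (c a).1 * ‖(c a).2‖) + (18 + 2 * Zmax) * C * empiricalEnergyField c χ := by
  have hR : empiricalDensityField c χ = empiricalDensityField c (fun y => (fun u => χ (x - u)) (x - y)) := by
    rw [← FluxClosureK.weight_eq_translate χ x]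
  have hMv : empiricalMomentumField c χ = empiricalMomentumField c (fun y => (fun u => χ (x - u)) (x - y)) := by
    rw [← FluxClosureK.weight_eq_translate χ x]
  have hEn : empiricalEnergyField c χ = empiricalEnergyField c (fun y => (fun u => χ (x - u)) (x - y)) := by
    rw [← FluxClosureK.weight_eq_translate χ x]
  obtain ⟨hR0, hEn0, h1, h2⟩ :=
    abs_reynolds_le_and_abs_pressure_le c x (k := fun u => χ (x - u)) (fun y => hχ _) hR hMv hEn
  set R : ℝ := empiricalDensityField c χ with hRdef
  set Mv : V3 := empiricalMomentumField c χ with hMvdef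
  set En : ℝ := empiricalEnergyField c χ with hEndef
  have hC0 : 0 ≤ C := (abs_nonneg _).trans (hC 0 0 x)
  have hZ0 : 0 ≤ Zmax := (abs_nonneg _).trans (hZ 0 ⟨le_rfl, hη₁⟩)
  have hdiv : |Torus.divergence φ x| ≤ 3 * C := by
    unfold Torus.divergence
    calc |∑ i, Torus.partialDeriv i (fun y => φ y i) x|
        ≤ ∑ i, |Torus.partialDeriv i (fun y => φ y i) x| := Finset.abs_sum_le_sum_abs _ _
      _ ≤ ∑ _i : Fin 3, C := Finset.sum_le_sum fun i _ => hC i i x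
      _ = 3 * C := by simp
  have hmin : min (R * σ ^ 3) η₁ ∈ Icc 0 η₁ :=
    ⟨le_min (mul_nonneg hR0 (pow_nonneg hσ 3)) hη₁, min_le_right _ _⟩
  have hZc : |hsCompressibility (min (R * σ ^ 3) η₁)| ≤ Zmax := hZ _ hmin
  have hA : |inner ℝ Mv (ψ x)| ≤ W₁ * ((n : ℝ)⁻¹ * ∑ a, χ (c a).1 * ‖(c a).2‖) :=
    abs_inner_momentum_le c hχ hW₁ x
  have hB : |∑ i, ∑ j, Mv i * Mv j / R * Torus.partialDeriv j (fun y => φ y i) x| ≤ 18 * C * En := by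
    calc |∑ i, ∑ j, Mv i * Mv j / R * Torus.partialDeriv j (fun y => φ y i) x|
        ≤ ∑ _i : Fin 3, ∑ _j : Fin 3, 2 * En * C := by
          refine (Finset.abs_sum_le_sum_abs _ _).trans (Finset.sum_le_sum fun i _ => ?_)
          refine (Finset.abs_sum_le_sum_abs _ _).trans (Finset.sum_le_sum fun j _ => ?_)
          rw [abs_mul]
          exact mul_le_mul (h1 i j) (hC i j x) (abs_nonneg _) (by linarith)
      _ = 18 * C * En := by
          simp only [Finset.sum_const, Finset.card_univ, Fintype.card_fin]
          ring
  have hCc : |R * (2 / 3 * (En / R - ‖Mv‖ ^ 2 / (2 * R ^ 2))) * hsCompressibility (min (R * σ ^ 3) η₁) *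
      Torus.divergence φ x| ≤ 2 * Zmax * C * En := by
    rw [abs_mul, abs_mul]
    calc |R * (2 / 3 * (En / R - ‖Mv‖ ^ 2 / (2 * R ^ 2)))| * |hsCompressibility (min (R * σ ^ 3) η₁)| *
          |Torus.divergence φ x| ≤ 2 / 3 * En * Zmax * (3 * C) :=
          mul_le_mul (mul_le_mul h2 hZc (abs_nonneg _) (by linarith)) hdiv (abs_nonneg _)
            (mul_nonneg (by linarith) hZ0)
      _ = 2 * Zmax * C * En := by ring
  calc _ ≤ |inner ℝ Mv (ψ x) + ∑ i, ∑ j, Mv i * Mv j / R * Torus.partialDeriv j (fun y => φ y i) x| +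
        |R * (2 / 3 * (En / R - ‖Mv‖ ^ 2 / (2 * R ^ 2))) * hsCompressibility (min (R * σ ^ 3) η₁) *
          Torus.divergence φ x| := abs_add_le _ _
    _ ≤ (|inner ℝ Mv (ψ x)| + |∑ i, ∑ j, Mv i * Mv j / R * Torus.partialDeriv j (fun y => φ y i) x|) +
        2 * Zmax * C * En := add_le_add (abs_add_le _ _) hCc
    _ ≤ (W₁ * ((n : ℝ)⁻¹ * ∑ a, χ (c a).1 * ‖(c a).2‖) + 18 * C * En) + 2 * Zmax * C * En :=
        add_le_add (add_le_add hA hB) le_rfl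
    _ = W₁ * ((n : ℝ)⁻¹ * ∑ a, χ (c a).1 * ‖(c a).2‖) + (18 + 2 * Zmax) * C * En := by ring

/-- The cube kernel read at the particles, `x ↦ K_ℓ(x, q)`, is integrable in the centre variable. [folklore] -/
theorem integrable_boxK_left (l : ℝ) (hl : 0 ≤ l) (q : T3) :
    Integrable (fun x : T3 => Set.indicator {y' : T3 | ∀ i, ‖y' i - x i‖ < l / 2} (fun _ => (l ^ 3)⁻¹) q) :=
  (integrable_const ((l ^ 3)⁻¹)).mono' (FluxClosureB2.measurable_boxK_left l q).aestronglyMeasurable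
    (ae_of_all _ fun x => FluxClosureB2.norm_boxK_le hl x q)

/-- **Boundary pairing, space-integrated** (cube kernel, `0 < ℓ ≤ 1`, `‖φ‖ ≤ W`):
`|∫ ⟪m̂(x), φ(x)⟫ dx| ≤ W · n⁻¹Σ_a‖v_a‖`. [folklore] -/
theorem abs_integral_inner_momentum_le (c : Config n (Fin 3) T3) {l : ℝ} (hl : 0 < l) (hl1 : l ≤ 1)
    {φ : T3 → V3} {W : ℝ} (hW : ∀ x, ‖φ x‖ ≤ W) :
    |∫ x : T3, inner ℝ (empiricalMomentumField c
        (fun y => Set.indicator {y' : T3 | ∀ i, ‖y' i - x i‖ < l / 2} (fun _ => (l ^ 3)⁻¹) y)) (φ x)| ≤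
      W * ((n : ℝ)⁻¹ * ∑ a, ‖(c a).2‖) := by
  have hg : Integrable (fun x : T3 => W * ((n : ℝ)⁻¹ * ∑ a,
      Set.indicator {y' : T3 | ∀ i, ‖y' i - x i‖ < l / 2} (fun _ => (l ^ 3)⁻¹) (c a).1 * ‖(c a).2‖)) :=
    ((integrable_finsetSum _ fun a _ => (integrable_boxK_left l hl.le (c a).1).mul_const _).const_mul _).const_mul _
  rw [← Real.norm_eq_abs]
  refine (norm_integral_le_of_norm_le hg (ae_of_all _ fun x => ?_)).trans_eq ?_
  · rw [Real.norm_eq_abs]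
    exact abs_inner_momentum_le c (fun y => LGFS.boxK_nonneg hl.le x y) hW x
  · rw [integral_const_mul, integral_const_mul,
      integral_finsetSum _ (fun a _ => (integrable_boxK_left l hl.le (c a).1).mul_const _)]
    congr 1
    congr 1
    refine Finset.sum_congr rfl fun a _ => ?_
    rw [integral_mul_const, FluxClosureK.integral_boxK_left hl hl1 (c a).1, one_mul]

/-- **Interior integrand, space-integrated** (cube kernel, `0 < ℓ ≤ 1`):
`|∫ (⟪m̂, ψ⟫ + (m̂⊗m̂/ρ̂):∇φ + ρ̂θ̂ Z(min(ρ̂σ³,η₁)) div φ) dx| ≤ W₁ n⁻¹Σ‖v_a‖ + (9 + Z_max) C n⁻¹Σ‖v_a‖²`. [folklore] -/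
theorem abs_integral_interior_le (c : Config n (Fin 3) T3) {l : ℝ} (hl : 0 < l) (hl1 : l ≤ 1)
    {ψ φ : T3 → V3} {W₁ C : ℝ} (hW₁ : ∀ y, ‖ψ y‖ ≤ W₁)
    (hC : ∀ i j y, |Torus.partialDeriv j (fun y => φ y i) y| ≤ C)
    {σ η₁ Zmax : ℝ} (hσ : 0 ≤ σ) (hη₁ : 0 ≤ η₁) (hZ : ∀ η ∈ Icc 0 η₁, |hsCompressibility η| ≤ Zmax) :
    |∫ x : T3, (inner ℝ (empiricalMomentumField c
          (fun y => Set.indicator {y' : T3 | ∀ i, ‖y' i - x i‖ < l / 2} (fun _ => (l ^ 3)⁻¹) y)) (ψ x) +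
        (∑ i, ∑ j,
          empiricalMomentumField c (fun y => Set.indicator {y' : T3 | ∀ i, ‖y' i - x i‖ < l / 2} (fun _ => (l ^ 3)⁻¹) y) i *
            empiricalMomentumField c (fun y => Set.indicator {y' : T3 | ∀ i, ‖y' i - x i‖ < l / 2} (fun _ => (l ^ 3)⁻¹) y) j /
            empiricalDensityField c (fun y => Set.indicator {y' : T3 | ∀ i, ‖y' i - x i‖ < l / 2} (fun _ => (l ^ 3)⁻¹) y) *
          Torus.partialDeriv j (fun y => φ y i) x) +
        empiricalDensityField c (fun y => Set.indicator {y' : T3 | ∀ i, ‖y' i - x i‖ < l / 2} (fun _ => (l ^ 3)⁻¹) y) *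
          (2 / 3 * (empiricalEnergyField c (fun y => Set.indicator {y' : T3 | ∀ i, ‖y' i - x i‖ < l / 2} (fun _ => (l ^ 3)⁻¹) y) /
              empiricalDensityField c (fun y => Set.indicator {y' : T3 | ∀ i, ‖y' i - x i‖ < l / 2} (fun _ => (l ^ 3)⁻¹) y) -
            ‖empiricalMomentumField c (fun y => Set.indicator {y' : T3 | ∀ i, ‖y' i - x i‖ < l / 2} (fun _ => (l ^ 3)⁻¹) y)‖ ^ 2 /
              (2 * empiricalDensityField c (fun y => Set.indicator {y' : T3 | ∀ i, ‖y' i - x i‖ < l / 2} (fun _ => (l ^ 3)⁻¹) y) ^ 2))) *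
          hsCompressibility (min (empiricalDensityField c
            (fun y => Set.indicator {y' : T3 | ∀ i, ‖y' i - x i‖ < l / 2} (fun _ => (l ^ 3)⁻¹) y) * σ ^ 3) η₁) *
          Torus.divergence φ x)| ≤
      W₁ * ((n : ℝ)⁻¹ * ∑ a, ‖(c a).2‖) + (9 + Zmax) * C * ((n : ℝ)⁻¹ * ∑ a, ‖(c a).2‖ ^ 2) := by
  have hK0 : ∀ x y : T3, 0 ≤ Set.indicator {y' : T3 | ∀ i, ‖y' i - x i‖ < l / 2} (fun _ => (l ^ 3)⁻¹) y :=
    fun x y => LGFS.boxK_nonneg hl.le x y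
  have hg : Integrable (fun x : T3 =>
      W₁ * ((n : ℝ)⁻¹ * ∑ a, Set.indicator {y' : T3 | ∀ i, ‖y' i - x i‖ < l / 2} (fun _ => (l ^ 3)⁻¹) (c a).1 * ‖(c a).2‖) +
      (18 + 2 * Zmax) * C * ((n : ℝ)⁻¹ * ∑ a,
        Set.indicator {y' : T3 | ∀ i, ‖y' i - x i‖ < l / 2} (fun _ => (l ^ 3)⁻¹) (c a).1 * (‖(c a).2‖ ^ 2 / 2))) :=
    (((integrable_finsetSum _ fun a _ => (integrable_boxK_left l hl.le (c a).1).mul_const _).const_mul _).const_mul _).add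
      (((integrable_finsetSum _ fun a _ => (integrable_boxK_left l hl.le (c a).1).mul_const _).const_mul _).const_mul _)
  rw [← Real.norm_eq_abs]
  refine (norm_integral_le_of_norm_le hg (ae_of_all _ fun x => ?_)).trans_eq ?_
  · rw [Real.norm_eq_abs]
    refine (abs_interiorIntegrand_le c x (hK0 x) hW₁ hC hσ hη₁ hZ).trans_eq ?_
    rw [empiricalEnergyField_eq_sum]
  · rw [integral_add, integral_const_mul, integral_const_mul, integral_const_mul, integral_const_mul,
      integral_finsetSum _ (fun a _ => (integrable_boxK_left l hl.le (c a).1).mul_const _),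
      integral_finsetSum _ (fun a _ => (integrable_boxK_left l hl.le (c a).1).mul_const _)]
    · have h1 : ∀ a : Fin n, ∫ x : T3, Set.indicator {y' : T3 | ∀ i, ‖y' i - x i‖ < l / 2} (fun _ => (l ^ 3)⁻¹) (c a).1 *
          ‖(c a).2‖ = ‖(c a).2‖ := fun a => by
        rw [integral_mul_const, FluxClosureK.integral_boxK_left hl hl1 (c a).1, one_mul]
      have h2 : ∀ a : Fin n, ∫ x : T3, Set.indicator {y' : T3 | ∀ i, ‖y' i - x i‖ < l / 2} (fun _ => (l ^ 3)⁻¹) (c a).1 *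
          (‖(c a).2‖ ^ 2 / 2) = ‖(c a).2‖ ^ 2 / 2 := fun a => by
        rw [integral_mul_const, FluxClosureK.integral_boxK_left hl hl1 (c a).1, one_mul]
      simp_rw [h1, h2]
      rw [← Finset.sum_div]
      ring
    · exact ((integrable_finsetSum _ fun a _ => (integrable_boxK_left l hl.le (c a).1).mul_const _).const_mul _).const_mul _
    · exact ((integrable_finsetSum _ fun a _ => (integrable_boxK_left l hl.le (c a).1).mul_const _).const_mul _).const_mul _

/-- AM–GM for the mean speed: `n⁻¹Σ‖v_a‖ ≤ (1 + n⁻¹Σ‖v_a‖²)/2`. [folklore] -/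
theorem avg_norm_le (c : Config n (Fin 3) T3) :
    (n : ℝ)⁻¹ * ∑ a, ‖(c a).2‖ ≤ (1 + (n : ℝ)⁻¹ * ∑ a, ‖(c a).2‖ ^ 2) / 2 := by
  have hc0 : 0 ≤ (n : ℝ)⁻¹ := inv_nonneg.2 (Nat.cast_nonneg n)
  have h1 : ∑ a, ‖(c a).2‖ ≤ ∑ a : Fin n, (1 + ‖(c a).2‖ ^ 2) / 2 :=
    Finset.sum_le_sum fun a _ => by nlinarith [sq_nonneg (‖(c a).2‖ - 1), norm_nonneg (c a).2]
  have h2 : ∑ a : Fin n, (1 + ‖(c a).2‖ ^ 2) / 2 = ((n : ℝ) + ∑ a, ‖(c a).2‖ ^ 2) / 2 := by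
    rw [← Finset.sum_div, Finset.sum_add_distrib, Finset.sum_const, Finset.card_univ, Fintype.card_fin,
      nsmul_eq_mul, mul_one]
  have h3 : (n : ℝ)⁻¹ * (n : ℝ) ≤ 1 := by
    rcases Nat.eq_zero_or_pos n with hn | hn
    · subst hn; simp
    · rw [inv_mul_cancel₀ (by exact_mod_cast hn.ne')]
  calc (n : ℝ)⁻¹ * ∑ a, ‖(c a).2‖ ≤ (n : ℝ)⁻¹ * (((n : ℝ) + ∑ a, ‖(c a).2‖ ^ 2) / 2) :=
        mul_le_mul_of_nonneg_left (h1.trans_eq h2) hc0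
    _ = ((n : ℝ)⁻¹ * (n : ℝ) + (n : ℝ)⁻¹ * ∑ a, ‖(c a).2‖ ^ 2) / 2 := by ring
    _ ≤ (1 + (n : ℝ)⁻¹ * ∑ a, ‖(c a).2‖ ^ 2) / 2 := by linarith

/-! ### Pathwise bounds in the crux's vocabulary -/

/-- **Boundary terms** (crux vocabulary: cube kernel `K`, box momentum `Mm`): on a good orbit, for `t ∈ [0, τ]`
and `‖w‖ ≤ W₀` there, `|∫ ⟪m̂(t), w(t)⟫ dx| ≤ W₀ (1 + (N+1)⁻¹Σ_a‖v_a(0)‖²)/2` (unit kernel mass, `‖v‖ ≤ (1+‖v‖²)/2`,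
energy conservation). [folklore] -/
theorem abs_boundary_le : ∀ (ε : ℕ → ℝ) (Φ : (N : ℕ) → HardSphereFlow (Torus.geometry (Fin 3)) (ε N) (N + 1)) (ℓ : ℕ → ℝ), (∀ N, 0 < ℓ N ∧ ℓ N ≤ 1) → let K := fun (l : ℝ) (x y : T3) => indicator {y' : T3 | ∀ i, ‖y' i - x i‖ < l / 2} (fun _ => (l ^ 3)⁻¹) y; let Mm := fun N t z x => empiricalMomentumField ((Φ N).flow t z) (K (ℓ N) x); ∀ (τ : ℝ) (w : ℝ → T3 → V3) (W₀ : ℝ), 0 ≤ W₀ → (∀ t ∈ Icc 0 τ, ∀ x, ‖w t x‖ ≤ W₀) → ∀ (N : ℕ) (z : Config (N + 1) (Fin 3) T3), z ∈ (Φ N).good → ∀ t ∈ Icc 0 τ, |∫ x, inner ℝ (Mm N t z x) (w t x)| ≤ W₀ * ((1 + (((N + 1 : ℕ)) : ℝ)⁻¹ * ∑ a, ‖(z a).2‖ ^ 2) / 2) := by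
  intro ε Φ ℓ hℓ
  dsimp only
  intro τ w W₀ hW0 hW N z hz t ht
  refine (abs_integral_inner_momentum_le ((Φ N).flow t z) (hℓ N).1 (hℓ N).2 (hW t ht)).trans ?_
  refine mul_le_mul_of_nonneg_left ?_ hW0
  refine (avg_norm_le ((Φ N).flow t z)).trans_eq ?_
  rw [sum_norm_sq_vel_flow (Φ N) hz t]

/-- **Interior terms** (crux vocabulary): on a good orbit, with `‖∂ₜw‖ ≤ W₁` on `(0, τ]`, `|∂_jw_i| ≤ C` on `[0, τ]`,
`0 ≤ σ`, `0 ≤ η₁` and `|Z| ≤ Z_max` on `[0, η₁]`,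
`|∫_0^τ∫ (⟪m̂, ∂ₜw⟫ + (m̂⊗m̂/ρ̂):∇w + p_cut div w)| ≤ τ (W₁ (1 + E₀)/2 + (9 + Z_max) C E₀)`, `E₀ = (N+1)⁻¹Σ_a‖v_a(0)‖²`
(`abs_integral_interior_le` at each frozen time, energy conservation, `|∫_(0,τ]| ≤ τ · sup`). [folklore] -/
theorem abs_interior_le : ∀ (σ η₁ T : ℝ) (Φ : (N : ℕ) → HardSphereFlow (Torus.geometry (Fin 3)) (hsDiameter σ N) (N + 1)) (ℓ : ℕ → ℝ), (∀ N, 0 < ℓ N ∧ ℓ N ≤ 1) → 0 ≤ σ → 0 ≤ η₁ → ∀ (Zmax : ℝ), (∀ η ∈ Icc 0 η₁, |hsCompressibility η| ≤ Zmax) → let K := fun (l : ℝ) (x y : T3) => indicator {y' : T3 | ∀ i, ‖y' i - x i‖ < l / 2} (fun _ => (l ^ 3)⁻¹) y; let Dn := fun N t z x => empiricalDensityField ((Φ N).flow t z) (K (ℓ N) x); let Mm := fun N t z x => empiricalMomentumField ((Φ N).flow t z) (K (ℓ N) x); let En := fun N t z x => empiricalEnergyField ((Φ N).flow t z) (K (ℓ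 N) x); let Th := fun (r : ℝ) (m : V3) (E : ℝ) => 2 / 3 * (E / r - ‖m‖ ^ 2 / (2 * r ^ 2)); let Zc := fun η : ℝ => hsCompressibility (min η η₁); let Pc := fun r ϑ : ℝ => r * ϑ * Zc (r * σ ^ 3); ∀ τ ∈ Ico 0 T, ∀ (w : ℝ → T3 → V3) (W₁ C : ℝ), 0 ≤ W₁ → (∀ t ∈ Ioc 0 τ, ∀ x, ‖Torus.timeDerivWithin (Ico 0 T) w t x‖ ≤ W₁) → (∀ t ∈ Icc 0 τ, ∀ (i j : Fin 3) (x : T3), |Torus.partialDeriv j (fun y => w t y i) x| ≤ C) → ∀ (N : ℕ) (z : Config (N + 1) (Fin 3) T3), z ∈ (Φ N).good → |∫ t in Ioc 0 τ, ∫ x, (inner ℝ (Mm N t z x) (Torus.timeDerivWithin (Ico 0 T) w t x) + (∑ i, ∑ j, Mm N t z x i * Mm N t z x j / Dn N t z x * Torus.partialDeriv j (fun y => w t y i) x) + Pc (Dn N t z x) (Th (Dn N t z x) (Mm N t z x) (En N t z x)) * Torus.divergence (w t) x)| ≤ τ * (W₁ * ((1 + (((N + 1 : ℕ)) : ℝ)⁻¹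 * ∑ a, ‖(z a).2‖ ^ 2) / 2) + (9 + Zmax) * C * ((((N + 1 : ℕ)) : ℝ)⁻¹ * ∑ a, ‖(z a).2‖ ^ 2)) := by
  intro σ η₁ T Φ ℓ hℓ hσ hη₁ Zmax hZ
  dsimp only
  intro τ hτ w W₁ C hW₁0 hDt hC N z hz
  rw [← Real.norm_eq_abs]
  refine (norm_setIntegral_le_of_norm_le_const (C := W₁ * ((1 + (((N + 1 : ℕ)) : ℝ)⁻¹ * ∑ a, ‖(z a).2‖ ^ 2) / 2) + (9 + Zmax) * C * ((((N + 1 : ℕ)) : ℝ)⁻¹ * ∑ a, ‖(z a).2‖ ^ 2))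
    measure_Ioc_lt_top fun t ht => ?_).trans_eq ?_
  · rw [Real.norm_eq_abs]
    refine (abs_integral_interior_le ((Φ N).flow t z) (hℓ N).1 (hℓ N).2 (hDt t ht) (hC t ⟨ht.1.le, ht.2⟩)
      hσ hη₁ hZ).trans ?_
    have h1 := avg_norm_le ((Φ N).flow t z)
    rw [sum_norm_sq_vel_flow (Φ N) hz t] at h1 ⊢
    have h2 := mul_le_mul_of_nonneg_left h1 hW₁0
    linarith
  · rw [Real.volume_real_Ioc_of_le hτ.1, sub_zero, mul_comm]

/-- **Kinetic deviation** (crux vocabulary): on a good orbit, with `|∂_jw_i| ≤ C` on `[0, τ]`,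
`|KinDev_N(z)| ≤ τ · 19 C (N+1)⁻¹Σ_a‖v_a(0)‖²` (`FluxClosureK.abs_integral_kinIntegrand_le` at each frozen time,
energy conservation). [folklore] -/
theorem abs_kinDev_le : ∀ (ε : ℕ → ℝ) (T : ℝ) (Φ : (N : ℕ) → HardSphereFlow (Torus.geometry (Fin 3)) (ε N) (N + 1)) (ℓ : ℕ → ℝ), (∀ N, 0 < ℓ N ∧ ℓ N ≤ 1) → let K := fun (l : ℝ) (x y : T3) => indicator {y' : T3 | ∀ i, ‖y' i - x i‖ < l / 2} (fun _ => (l ^ 3)⁻¹) y; let Dn := fun N t z x => empiricalDensityField ((Φ N).flow t z) (K (ℓ N) x); let Mm := fun N t z x => empiricalMomentumField ((Φ N).flow t z) (K (ℓ N) x); let En := fun N t z x => empiricalEnergyField ((Φ N).flow t z) (K (ℓ N) x); let Sk := fun N t z x (i j : Fin 3) => ∫ y, K (ℓ N) x y.1 * (y.2 i * y.2 j) ∂(empiricalMeasure ((Φ N).flow t z)); let Th := fun (r : ℝ) (m : V3) (E : ℝ) => 2 / 3 * (E / r - ‖m‖ ^ 2 / (2 * r ^ 2)); ∀ τ ∈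 Ico 0 T, ∀ (w : ℝ → T3 → V3) (C : ℝ), (∀ t ∈ Icc 0 τ, ∀ (i j : Fin 3) (x : T3), |Torus.partialDeriv j (fun y => w t y i) x| ≤ C) → ∀ (N : ℕ) (z : Config (N + 1) (Fin 3) T3), z ∈ (Φ N).good → |∫ t in Ioc 0 τ, ∫ x, ∑ i, ∑ j, (Sk N t z x i j - Mm N t z x i * Mm N t z x j / Dn N t z x - (if i = j then Dn N t z x * Th (Dn N t z x) (Mm N t z x) (En N t z x) else 0)) * Torus.partialDeriv j (fun y => w t y i) x| ≤ τ * (19 * C * ((((N + 1 : ℕ)) : ℝ)⁻¹ * ∑ a, ‖(z a).2‖ ^ 2)) := by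
  intro ε T Φ ℓ hℓ
  dsimp only
  intro τ hτ w C hC N z hz
  rw [← Real.norm_eq_abs]
  refine (norm_setIntegral_le_of_norm_le_const (C := 19 * C * ((((N + 1 : ℕ)) : ℝ)⁻¹ * ∑ a, ‖(z a).2‖ ^ 2)) measure_Ioc_lt_top fun t ht => ?_).trans_eq ?_
  · rw [Real.norm_eq_abs]
    refine (FluxClosureK.abs_integral_kinIntegrand_le ((Φ N).flow t z) (hℓ N).1 (hℓ N).2
      (hC t ⟨ht.1.le, ht.2⟩)).trans_eq ?_
    rw [sum_norm_sq_vel_flow (Φ N) hz t]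
  · rw [Real.volume_real_Ioc_of_le hτ.1, sub_zero, mul_comm]

/-- **Pathwise bound on the collisional deviation** (crux vocabulary, incl. the collision functional `Cw`): on a
good orbit, with `‖w‖ ≤ W₀` and `|∂_jw_i| ≤ C` on `[0, τ]`, `‖∂ₜw‖ ≤ W₁` on `(0, τ]`, `0 ≤ σ`, `0 ≤ η₁`,
`|Z| ≤ Z_max` on `[0, η₁]`:
`|C_w − ∫_0^τ∫ ρ̂θ̂ (Z(min(ρ̂σ³,η₁)) − 1) div w| ≤ (W₀ + τW₁/2 + τC(28 + Z_max)) (1 + (N+1)⁻¹Σ_a‖v_a(0)‖²)`.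
Proof: rewrite `CollDev = D − KinDev` by the exact balance identity `FluxClosureGlue.boxMomentumBalance` and add
the three bounds above (`|a − b − c| ≤ |a| + |b| + |c|`); no collision estimate enters. [folklore] -/
theorem abs_collDev_le : ∀ (σ η₁ T : ℝ) (Φ : (N : ℕ) → HardSphereFlow (Torus.geometry (Fin 3)) (hsDiameter σ N) (N + 1)) (ℓ : ℕ → ℝ), (∀ N, 0 < ℓ N ∧ ℓ N ≤ 1) → 0 ≤ σ → 0 ≤ η₁ → ∀ (Zmax : ℝ), (∀ η ∈ Icc 0 η₁, |hsCompressibility η| ≤ Zmax) → let K := fun (l : ℝ) (x y : T3) => indicator {y' : T3 | ∀ i, ‖y' i - x i‖ < l / 2} (fun _ => (l ^ 3)⁻¹) y; let Dn := fun N t z x => empiricalDensityField ((Φ N).flow t z) (K (ℓ N) x); let Mm := fun N t z x => empiricalMomentumField ((Φ N).flow t z) (K (ℓ N) x); let En := fun N t z x => empiricalEnergyField ((Φ N).flow t z) (K (ℓ N) x); let Th := fun (r : ℝ) (m : V3) (E : ℝ) => 2 / 3 * (E / r - ‖m‖ ^ 2 / (2 * r ^ 2)); let Zc := fun η : ℝ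 => hsCompressibility (min η η₁); ∀ τ ∈ Ico 0 T, ∀ w : ℝ → T3 → V3, Torus.IsSmoothSpaceTimeOn (Ico 0 T) w → ∀ (W₀ W₁ C : ℝ), 0 ≤ W₀ → 0 ≤ W₁ → 0 ≤ C → (∀ t ∈ Icc 0 τ, ∀ x, ‖w t x‖ ≤ W₀) → (∀ t ∈ Ioc 0 τ, ∀ x, ‖Torus.timeDerivWithin (Ico 0 T) w t x‖ ≤ W₁) → (∀ t ∈ Icc 0 τ, ∀ (i j : Fin 3) (x : T3), |Torus.partialDeriv j (fun y => w t y i) x| ≤ C) → let Cw := fun N (z : Config (N + 1) (Fin 3) T3) => ∑ᶠ t ∈ collisionTimes (Torus.geometry (Fin 3)) (hsDiameter σ N) (fun s => (Φ N).flow s z) ∩ Ioc 0 τ, collisionJump (fun z' : Config (N + 1) (Fin 3) T3 => ((N : ℝ) + 1)⁻¹ * momentumObservable (fun q => ∫ x, K (ℓ N) x q • w t x) z') (fun s => (Φ N).flow s z) t; ∀ (N : ℕ) (z : Config (N + 1) (Fin 3) T3), z ∈ (Φ N).good → |Cw N z - ∫ t in Ioc 0 τ, ∫ x, Dn N t z x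 * Th (Dn N t z x) (Mm N t z x) (En N t z x) * (Zc (Dn N t z x * σ ^ 3) - 1) * Torus.divergence (w t) x| ≤ (W₀ + τ * W₁ / 2 + τ * C * (28 + Zmax)) * (1 + (((N + 1 : ℕ)) : ℝ)⁻¹ * ∑ a, ‖(z a).2‖ ^ 2) := by
  intro σ η₁ T Φ ℓ hℓ hσ hη₁ Zmax hZ
  dsimp only
  intro τ hτ w hw W₀ W₁ C hW0 hW₁0 hC0 hWt hDt hC N z hz
  have hZ0 : 0 ≤ Zmax := (abs_nonneg _).trans (hZ 0 ⟨le_rfl, hη₁⟩)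
  have hτ0 : 0 ≤ τ := hτ.1
  -- the exact balance identity (any profiles: only its pathwise conjunct is used)
  have hbal := FluxClosureGlue.boxMomentumBalance σ η₁ T (fun _ => 1) (fun _ => 1) (fun _ => 0) Φ ℓ hℓ
  dsimp only at hbal
  have heq := (hbal τ hτ w hw N).2 z hz
  rw [eq_sub_of_add_eq heq.symm]
  -- the four bounds
  have hB := abs_boundary_le (fun N => hsDiameter σ N) Φ ℓ hℓ
  dsimp only at hB
  have h1 := hB τ w W₀ hW0 hWt N z hz τ ⟨hτ0, le_rfl⟩
  have h2 := hB τ w W₀ hW0 hWt N z hz 0 ⟨le_rfl, hτ0⟩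
  have hI := abs_interior_le σ η₁ T Φ ℓ hℓ hσ hη₁ Zmax hZ
  dsimp only at hI
  have h3 := hI τ hτ w W₁ C hW₁0 hDt hC N z hz
  have hK := abs_kinDev_le (fun N => hsDiameter σ N) T Φ ℓ hℓ
  dsimp only at hK
  have h4 := hK τ hτ w C hC N z hz
  have key : ∀ a b c : ℝ, |a - b - c| ≤ |a| + |b| + |c| := fun a b c => by
    have := abs_sub (a - b) c
    have := abs_sub a b
    linarith
  refine ((abs_sub _ _).trans (add_le_add ((key _ _ _).trans (add_le_add (add_le_add h1 h2) h3)) h4)).trans ?_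
  set E : ℝ := (((N + 1 : ℕ)) : ℝ)⁻¹ * ∑ a, ‖(z a).2‖ ^ 2 with hE
  have hE0 : 0 ≤ E := by positivity
  nlinarith [mul_nonneg (mul_nonneg hτ0 hC0) (by linarith : (0 : ℝ) ≤ 28 + Zmax), mul_nonneg hW₁0 hE0,
    mul_nonneg hτ0 (mul_nonneg hW₁0 hE0)]

/-! ### The stub's functional is uniformly bounded in `L¹(P_N)` -/

/-- **Uniform `L¹(P_N)` tightness of the collisional deviation (stub V of crux `FluxClosure`; registered sub-goal).**
In the crux's vocabulary (cube kernel `K`, box fields `Dn, Mm, En`, box temperature `Th`, cut compressibility `Zc`,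
collision functional `Cw`): for `0 ≤ σ ≤ 1/2`, `0 ≤ η₁`, `|Z| ≤ Z_max` on `[0, η₁]`, continuous profiles `a₀, θ₀ > 0`,
`u₀` with `3θ₀ + ‖u₀‖² ≤ B₁`, every flow family, every window `0 < ℓ_N ≤ 1`, every `τ ∈ [0, T)` and every `w` smooth on
`[0,T) × 𝕋³` there is `C ≥ 0` with, FOR EVERY `N`,
`∫⁻ |C_w − ∫_0^τ∫ ρ̂θ̂ (Z(min(ρ̂σ³, η₁)) − 1) div w| dP_N ≤ C (1 + B₁)`.
Proof: bounds for `w, ∂ₜw, ∇w` on `[0,τ] × 𝕋³` by compactness; `abs_collDev_le` on the good set (conull, `P_N ≪`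
Liouville); `E_P[(N+1)⁻¹Σ‖v_a‖²] ≤ B₁` (Gaussian velocities, `lintegral_avg_norm_sq_vel_le`). So the `L¹(P_N)` norms
whose vanishing `stub_collisionalVirial` asserts are uniformly bounded although `C_w` is a collision sum; the stub's
content is the limit (local virial law along the deterministic flow), not finiteness. [folklore] -/
theorem collisionalVirial_tight : ∀ (σ : ℝ), 0 ≤ σ → σ ≤ 1 / 2 → ∀ (η₁ Zmax : ℝ), 0 ≤ η₁ → (∀ η ∈ Icc 0 η₁, |hsCompressibility η| ≤ Zmax) → ∀ (a₀ θ₀ : T3 → ℝ) (u₀ : T3 → V3), Continuous a₀ → Continuous θ₀ → Continuous u₀ → (∀ x, 0 < a₀ x) → (∀ x, 0 < θ₀ x) → ∀ (B₁ : ℝ), (∀ x, 3 * θ₀ x + ‖u₀ x‖ ^ 2 ≤ B₁) → ∀ (T : ℝ) (Φ : (N : ℕ) → HardSphereFlow (Torus.geometry (Fin 3)) (hsDiameter σ N) (N + 1)) (ℓ : ℕ → ℝ), (∀ N, 0 < ℓ N ∧ ℓ N ≤ 1) → let K := fun (l : ℝ) (x y : T3) => indicator {y' : T3 | ∀ i,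 ‖y' i - x i‖ < l / 2} (fun _ => (l ^ 3)⁻¹) y; let Dn := fun N t z x => empiricalDensityField ((Φ N).flow t z) (K (ℓ N) x); let Mm := fun N t z x => empiricalMomentumField ((Φ N).flow t z) (K (ℓ N) x); let En := fun N t z x => empiricalEnergyField ((Φ N).flow t z) (K (ℓ N) x); let Th := fun (r : ℝ) (m : V3) (E : ℝ) => 2 / 3 * (E / r - ‖m‖ ^ 2 / (2 * r ^ 2)); let Zc := fun η : ℝ => hsCompressibility (min η η₁); ∀ τ ∈ Ico 0 T, ∀ w : ℝ → T3 → V3, Torus.IsSmoothSpaceTimeOn (Ico 0 T) w → let Cw := fun N (z : Config (N + 1) (Fin 3) T3) => ∑ᶠ t ∈ collisionTimes (Torus.geometry (Fin 3)) (hsDiameter σ N) (fun s => (Φ N).flow s z) ∩ Ioc 0 τ, collisionJump (fun z' : Config (N + 1) (Fin 3) T3 => ((N : ℝ) + 1)⁻¹ * momentumObservable (fun q => ∫ x, K (ℓ N) x q • w t x) z') (fun s => (Φ N).flow s z) t; ∃ C : ℝ, 0 ≤ C ∧ ∀ N : ℕ, ∫⁻ z, ENNReal.ofReal (|Cw N z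 - ∫ t in Ioc 0 τ, ∫ x, Dn N t z x * Th (Dn N t z x) (Mm N t z x) (En N t z x) * (Zc (Dn N t z x * σ ^ 3) - 1) * Torus.divergence (w t) x|) ∂(localGibbsLaw σ a₀ u₀ θ₀ N (Φ N)) ≤ ENNReal.ofReal (C * (1 + B₁)) := by
  intro σ hσ0 hσ η₁ Zmax hη₁ hZ a₀ θ₀ u₀ ha hθ hu ha0 hθ0 B₁ hB₁ T Φ ℓ hℓ
  dsimp only
  intro τ hτ w hw
  have hτ0 : 0 ≤ τ := hτ.1
  have hτT : τ < T := hτ.2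
  -- bounds for `w`, `∂ₜw`, `∇w` on `[0, τ] × 𝕋³`
  obtain ⟨C, hC0, hC⟩ := FluxClosureK.exists_forall_abs_partialDeriv_le_slab hτT hw
  obtain ⟨W, hW⟩ := hw.exists_norm_le_of_isCompact isCompact_Icc (Icc_subset_Ico_right hτT)
  obtain ⟨H, C₁, -, hHt, -, hHb⟩ := FluxClosureB4.exists_measurable_fderiv hτT hw
  have hW0 : 0 ≤ max W 0 := le_max_right _ _
  have hW₁0 : 0 ≤ max C₁ 0 := le_max_right _ _
  have hWt : ∀ t ∈ Icc 0 τ, ∀ x, ‖w t x‖ ≤ max W 0 := fun t ht x => (hW t ht x).trans (le_max_left _ _)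
  have hDt : ∀ t ∈ Ioc 0 τ, ∀ x, ‖Torus.timeDerivWithin (Ico 0 T) w t x‖ ≤ max C₁ 0 := by
    intro t ht x
    have htT : t ∈ Ico 0 T := ⟨ht.1.le, lt_of_le_of_lt ht.2 hτT⟩
    rw [hHt t htT x]
    calc ‖H (t, x) (1, 0)‖ ≤ ‖H (t, x)‖ * ‖((1 : ℝ), (0 : EuclideanSpace ℝ (Fin 3)))‖ :=
          ContinuousLinearMap.le_opNorm _ _
      _ ≤ C₁ * 1 := by
          refine mul_le_mul (hHb t ⟨ht.1.le, ht.2⟩ x) ?_ (norm_nonneg _)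
            ((norm_nonneg _).trans (hHb t ⟨ht.1.le, ht.2⟩ x))
          rw [Prod.norm_def, norm_one, norm_zero, max_eq_left zero_le_one]
      _ ≤ max C₁ 0 := by rw [mul_one]; exact le_max_left _ _
  have hZ0 : 0 ≤ Zmax := (abs_nonneg _).trans (hZ 0 ⟨le_rfl, hη₁⟩)
  set Bc : ℝ := max W 0 + τ * max C₁ 0 / 2 + τ * C * (28 + Zmax) with hBc
  have hBc0 : 0 ≤ Bc := by positivity
  refine ⟨Bc, hBc0, fun N => ?_⟩
  -- pathwise bound on the good set
  have hP := abs_collDev_le σ η₁ T Φ ℓ hℓ hσ0 hη₁ Zmax hZ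
  dsimp only at hP
  have hPN := hP τ hτ w hw (max W 0) (max C₁ 0) C hW0 hW₁0 hC0 hWt hDt hC N
  -- measure facts
  have hPac : localGibbsLaw σ a₀ u₀ θ₀ N (Φ N) ≪ liouville (Torus.geometry (Fin 3)) (N + 1) (hsDiameter σ N) :=
    particleLaw_absolutelyContinuous (Φ N) _
  have hgood : ∀ᵐ z ∂(localGibbsLaw σ a₀ u₀ θ₀ N (Φ N)), z ∈ (Φ N).good := hPac.ae_le (Φ N).ae_mem_good
  haveI : IsProbabilityMeasure (particleLaw (Φ N) (canonicalDensity (Torus.geometry (Fin 3)) (hsDiameter σ N) (N + 1)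
      (localGibbsProfile a₀ u₀ θ₀))) := isProbabilityMeasure_localGibbsLaw ha hθ hu ha0 hθ0 hσ N (Φ N)
  haveI : IsProbabilityMeasure (localGibbsLaw σ a₀ u₀ θ₀ N (Φ N)) :=
    isProbabilityMeasure_localGibbsLaw ha hθ hu ha0 hθ0 hσ N (Φ N)
  have hE : ∫⁻ z, ENNReal.ofReal ((((N + 1 : ℕ)) : ℝ)⁻¹ * ∑ a, ‖(z a).2‖ ^ 2) ∂(localGibbsLaw σ a₀ u₀ θ₀ N (Φ N)) ≤ ENNReal.ofReal B₁ :=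
    lintegral_avg_norm_sq_vel_le (Φ N) ha hθ hu (fun x => (ha0 x).le) hθ0 hB₁
  have hmeas : Measurable fun z : Config (N + 1) (Fin 3) T3 => ENNReal.ofReal ((((N + 1 : ℕ)) : ℝ)⁻¹ * ∑ a, ‖(z a).2‖ ^ 2) :=
    (measurable_const.mul (Finset.measurable_sum _ fun i _ =>
      ((measurable_pi_apply i).snd).norm.pow_const 2)).ennreal_ofReal
  calc _ ≤ ∫⁻ z, ENNReal.ofReal (Bc * (1 + (((N + 1 : ℕ)) : ℝ)⁻¹ * ∑ a, ‖(z a).2‖ ^ 2)) ∂(localGibbsLaw σ a₀ u₀ θ₀ N (Φ N)) :=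
        lintegral_mono_ae (hgood.mono fun z hz => ENNReal.ofReal_le_ofReal (hPN z hz))
    _ = ENNReal.ofReal Bc * ∫⁻ z, (ENNReal.ofReal 1 + ENNReal.ofReal ((((N + 1 : ℕ)) : ℝ)⁻¹ * ∑ a, ‖(z a).2‖ ^ 2)) ∂(localGibbsLaw σ a₀ u₀ θ₀ N (Φ N)) := by
        rw [← lintegral_const_mul' _ _ ENNReal.ofReal_ne_top]
        refine lintegral_congr fun z => ?_
        rw [← ENNReal.ofReal_add zero_le_one (by positivity), ← ENNReal.ofReal_mul hBc0]
    _ = ENNReal.ofReal Bc * (1 + ∫⁻ z, ENNReal.ofReal ((((N + 1 : ℕ)) : ℝ)⁻¹ * ∑ a, ‖(z a).2‖ ^ 2) ∂(localGibbsLaw σ a₀ u₀ θ₀ N (Φ N))) := by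
        rw [lintegral_add_right _ hmeas, ENNReal.ofReal_one, lintegral_const, measure_univ, mul_one]
    _ ≤ ENNReal.ofReal Bc * (1 + ENNReal.ofReal B₁) := by gcongr
    _ = ENNReal.ofReal (Bc * (1 + B₁)) := by
        have hB₁0 : 0 ≤ B₁ := le_trans (by have := hθ0 0; positivity) (hB₁ 0)
        rw [← ENNReal.ofReal_one, ← ENNReal.ofReal_add zero_le_one hB₁0, ← ENNReal.ofReal_mul hBc0]

end FluxClosureVT
end Summit.AtomisticToContinuum.HydrodynamicLimit.Theorems

end
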